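import Literature.NumberTheory.PAdicHodge.DeRhamBaseChange
import Literature.NumberTheory.PAdicHodge.FontaineDpst
import Literature.NumberTheory.PAdicHodge.LocalFieldEmbeddingNorm
import Literature.NumberTheory.PAdicHodge.CompletedAlgClosureBaseChange
import Literature.NumberTheory.PAdicHodge.BdRBaseChange
import Literature.NumberTheory.GaloisRepresentations.AdmissibleRestrictOfRingEquiv
import Literature.NumberTheory.GaloisRepresentations.PstWeilDeligneModelIndependence
import Literature.NumberTheory.GaloisRepresentations.AbsGaloisGroupProofs
import HarnessLib

/-!
# Discharge of the named fact `DeRhamBaseChange` (Brinon–Conrad 2009, Prop. 6.3.8, tree form)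

Sibling proof file of `Literature/NumberTheory/PAdicHodge/DeRhamBaseChange.lean` (D-0014): it
proves `theorem DeRhamBaseChange_holds : DeRhamBaseChange` — for a CONTINUOUS embedding `K → L` of
characteristic-`0` non-archimedean local fields of residue characteristic `ℓ` and a framed
`ρ : Γ_K →ₜ* GL_n(ℚ̄_ℓ)` de Rham for THE pinned datum `fontainePst K ℓ hK` (whose period ring IS
the constructed `B_dR(K)`, `fontainePst_𝔅_eq_bdRPeriodRingData`), the restriction
`ρ ∘ absGaloisRestrict K L` is de Rham for `fontainePst L ℓ hL`.

## Proof (Brinon–Conrad, discussion before Prop. 6.3.8, p. 80, and Fontaine 1994, Exp. III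
Thm. 1.5.2)

"The construction of `B_dR⁺` … only depends on `𝒪_{C_K}` endowed with its `G_K`-action": the
chosen `K`-embedding `ι = absClosureEmbedding K L : K̄ → L̄` (along which `absGaloisRestrict` is
defined) is bijective (`L/K` is algebraic: `algebra_isAlgebraic_of_continuous_algebraMap`, file
`LocalFieldEmbeddingNorm`, with the accepted `absClosureEmbedding_bijective`) and multiplies the
spectral norms in the exponent, `‖ι x‖_{L̄} = ‖x‖_{K̄}^c` (`exists_algNorm_absClosureEmbedding_eq_rpow`,
same file: equivalence of the two absolute values on `K` by continuity, then uniqueness of the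
extension of a complete absolute value to `K̄`); hence it extends to an isomorphism of valued fields
`ℂ_K ≅ ℂ_L` restricting to `g : 𝒪_{ℂ_K} ≃+* 𝒪_{ℂ_L}` with `g ∘ res(τ) = τ ∘ g`
(`exists_integerC_ringEquiv`, file `CompletedAlgClosureBaseChange`); functoriality of tilt, Witt
vectors, `θ[1/p]`, the `ker θ[1/p]`-adic completion and the fraction field along `g` gives
`Φ : B_dR(K) ≃+* B_dR(L)`, `Γ_L`-equivariant through `res` and `ℚ_ℓ`-linear
(`exists_fracBdR_ringEquiv`, file `BdRBaseChange`).  Finally (Fontaine's comparison criterion,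
Exp. III Thm. 1.5.2: `V` is `B`-admissible iff `D_B(V)` spans `B ⊗ V` over `B`) admissibility is
transported along the `Φ`-semilinear isomorphism `Φ ⊗ 1 : B_dR(K) ⊗ V → B_dR(L) ⊗ V`, which maps
`Γ_K`-invariants to `Γ_L`-invariants (`PeriodRingData.isAdmissible_restrict_of_ringEquiv`, file
`GaloisRepresentations/AdmissibleRestrictOfRingEquiv`).  The `ℚ_ℓ`-model bookkeeping
(`HasQlModel`, `restrictScalarsQl`) commutes with restriction definitionally.

* `isAdmissible_bdR_restrictField` — the transport for the canonical structures
  (`LocalField.padicAlgebra`, `bdRPeriodRingData`), stated with the pinning equations as hypotheses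
  so that it applies to `fontainePst` by `fontainePst_algebra_eq_padicAlgebra` /
  `fontainePst_𝔅_eq_bdRPeriodRingData` without dependent rewriting.
* `DeRhamBaseChange_holds` — the discharge.

## What is NOT here

* The converse (de Rham over `L` ⇒ de Rham over `K`) and the filtered statement
  `L ⊗_K D_{dR,K}(V) ≅ D_{dR,L}(V)` of Prop. 6.3.8; the general complete discretely-valued
  `K'/K ⊆ C_K`.  No definition, no new named fact, no `sorry`.

## References

* [BrinonConrad2009] O. Brinon, B. Conrad, *CMI Summer School notes on p-adic Hodge theory*
  (2009), Prop. 6.3.8 (p. 80) and the discussion preceding it.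
* [FontaineAsterisque223III] J.-M. Fontaine, *Le corps des périodes p-adiques*; *Représentations
  p-adiques semi-stables*, Astérisque 223 (1994), Exp. II §1.2, §1.5; Exp. III Thm. 1.5.2, §3.
-/

noncomputable section

open Field ValuativeRel WittVector
open Literature.NumberTheory.GaloisRepresentations
open Literature.NumberTheory.GaloisRepresentations.IsNonarchimedeanLocalField

namespace Literature.NumberTheory.PAdicHodge

section Assembly

variable {K L : Type} [Field K] [ValuativeRel K] [TopologicalSpace K] [IsNonarchimedeanLocalField K]
  [CharZero K] [Field L] [ValuativeRel L] [TopologicalSpace L] [IsNonarchimedeanLocalField L]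
  [CharZero L] [Algebra K L] {ℓ : ℕ} [Fact ℓ.Prime]

/-- **Transport of `B_dR`-admissibility along a continuous embedding of local fields** (the core
of Brinon–Conrad 2009, Prop. 6.3.8, for the canonical structures): for `K → L` continuous,
`hK : |ℓ|_K < 1`, `hL : |ℓ|_L < 1`, a `ℚ_ℓ`-structure `algK` on `K` EQUAL to the canonical
`LocalField.padicAlgebra K ℓ hK` and a period-ring datum `𝔅K` EQUAL to Fontaine's `B_dR(K)`
(`bdRPeriodRingData hK`), and likewise for `L`, every finite-dimensional continuous `ℚ_ℓ`-linear
`V` of `Γ_K` which is `𝔅K`-admissible has `𝔅L`-admissible restriction `V|_{Γ_L}`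
(`GaloisRep.restrictField L`, along `absGaloisRestrict K L`).  The pinning equations are
hypotheses (eliminated by `subst`) so that the statement applies verbatim to the `ε`-pinned datum
`fontainePst`.  Proof: `B_dR(K) ≃ B_dR(L)` equivariantly and `ℚ_ℓ`-linearly
(`exists_fracBdR_ringEquiv` ∘ `exists_integerC_ringEquiv` ∘ `exists_algNorm_absClosureEmbedding_eq_rpow`),
the `ℚ_ℓ`-structure maps of both data factor through `qpToBdR` (`embBdRHom_algebraMap`), then
`PeriodRingData.isAdmissible_restrict_of_ringEquiv`.
[cite: BrinonConrad2009, Prop. 6.3.8] [cite: FontaineAsterisque223III, Exp. III Thm. 1.5.2] -/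
theorem isAdmissible_bdR_restrictField (hcont : Continuous (algebraMap K L))
    (hK : valuation K (ℓ : K) < 1) (hL : valuation L (ℓ : L) < 1)
    [Fact (¬ IsUnit ((ℓ : ℕ) : integerC K))]
    [IsAdicComplete (Ideal.span {((ℓ : ℕ) : integerC K)}) (integerC K)]
    [Fact (¬ IsUnit ((ℓ : ℕ) : integerC L))]
    [IsAdicComplete (Ideal.span {((ℓ : ℕ) : integerC L)}) (integerC L)]
    (algK : Algebra ℚ_[ℓ] K) (𝔅K : PeriodRingData.{0, 0, 0, 0} (absoluteGaloisGroup K) ℚ_[ℓ] K)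
    (halgK : algK = LocalField.padicAlgebra K ℓ hK)
    (h𝔅K : 𝔅K = bdRPeriodRingData (F := K) (p := ℓ) hK)
    (algL : Algebra ℚ_[ℓ] L) (𝔅L : PeriodRingData.{0, 0, 0, 0} (absoluteGaloisGroup L) ℚ_[ℓ] L)
    (halgL : algL = LocalField.padicAlgebra L ℓ hL)
    (h𝔅L : 𝔅L = bdRPeriodRingData (F := L) (p := ℓ) hL)
    {M : Type} [AddCommGroup M] [Module ℚ_[ℓ] M] [TopologicalSpace M] [FiniteDimensional ℚ_[ℓ] M]
    (V : GaloisRep K ℚ_[ℓ] M) (hV : 𝔅K.IsAdmissible V) :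
    𝔅L.IsAdmissible (V.restrictField L) := by
  subst halgK halgL
  subst h𝔅K h𝔅L
  letI : Algebra ℚ_[ℓ] K := LocalField.padicAlgebra K ℓ hK
  letI : Algebra ℚ_[ℓ] L := LocalField.padicAlgebra L ℓ hL
  haveI := algebra_isAlgebraic_of_continuous_algebraMap hcont hK hL
  obtain ⟨g, hg⟩ := exists_integerC_ringEquiv (absClosureEmbedding_bijective K L)
    (exists_algNorm_absClosureEmbedding_eq_rpow hcont hK hL)
  obtain ⟨Φ, hΦ, hΦq⟩ := exists_fracBdR_ringEquiv (ℓ := ℓ) g hg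
  refine PeriodRingData.isAdmissible_restrict_of_ringEquiv (bdRPeriodRingData (F := K) (p := ℓ) hK)
    (bdRPeriodRingData (F := L) (p := ℓ) hL) (absGaloisRestrict K L) Φ (fun q => ?_) hΦ V hV
  have hFK : Function.Surjective (fontaineTheta (integerC K) ℓ) := surjective_fontaineTheta_integerC hK
  have hFL : Function.Surjective (fontaineTheta (integerC L) ℓ) := surjective_fontaineTheta_integerC hL
  have h1 : algebraMap ℚ_[ℓ] (bdRPeriodRingData (F := K) (p := ℓ) hK).B q =
      algebraMap (BDeRhamPlus (integerC K) ℓ) (FracBdR K ℓ) (qpToBdR q) := by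
    rw [PeriodRingData.algebraMap_eq]
    change algebraMap (BDeRhamPlus (integerC K) ℓ) (FracBdR K ℓ)
      (embBdRHom hK hFK (LocalField.padicRingHom K ℓ hK q)) = _
    rw [show LocalField.padicRingHom K ℓ hK q = algebraMap (PadicBase K ℓ hK) K ((PadicBase.toPadic hK).symm q)
      from rfl, embBdRHom_algebraMap]
    rfl
  have h2 : algebraMap ℚ_[ℓ] (bdRPeriodRingData (F := L) (p := ℓ) hL).B q =
      algebraMap (BDeRhamPlus (integerC L) ℓ) (FracBdR L ℓ) (qpToBdR q) := by
    rw [PeriodRingData.algebraMap_eq]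
    change algebraMap (BDeRhamPlus (integerC L) ℓ) (FracBdR L ℓ)
      (embBdRHom hL hFL (LocalField.padicRingHom L ℓ hL q)) = _
    rw [show LocalField.padicRingHom L ℓ hL q = algebraMap (PadicBase L ℓ hL) L ((PadicBase.toPadic hL).symm q)
      from rfl, embBdRHom_algebraMap]
    rfl
  rw [h1, h2]; exact hΦq q

/-- **`DeRhamBaseChange` holds** (Brinon–Conrad 2009, Prop. 6.3.8, tree form; Fontaine 1994,
Exp. III §1.5, §3): for a continuous embedding `K → L` of characteristic-`0` non-archimedean local
fields of residue characteristic `ℓ` and a framed `ρ : Γ_K →ₜ* GL_n(ℚ̄_ℓ)` de Rham for THE pinned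
datum `fontainePst K ℓ hK`, the restriction `ρ ∘ absGaloisRestrict K L` is de Rham for
`fontainePst L ℓ hL`.  Discharges the named fact of `DeRhamBaseChange.lean` (D-0014): take a finite
`ℚ_ℓ`-model `rE` of `ρ` (`IsDeRhamWith`), restrict it (`HasQlModel` of the restriction, by `rfl`),
and transport admissibility of its `ℚ_ℓ`-restriction of scalars by `isAdmissible_bdR_restrictField`
applied to the pinned data through `fontainePst_algebra_eq_padicAlgebra` and
`fontainePst_𝔅_eq_bdRPeriodRingData`.
[cite: BrinonConrad2009, Prop. 6.3.8] [cite: FontaineAsterisque223III, Exp. III §1.5 and §3] -/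
theorem DeRhamBaseChange_holds : DeRhamBaseChange := by
  intro K L _ _ _ _ _ _ _ _ _ _ _ hcont ℓ _ hK hL n ρ hρ
  haveI : Fact (¬ IsUnit ((ℓ : ℕ) : integerC K)) := ⟨not_isUnit_natCast_integerC hK⟩
  haveI : IsAdicComplete (Ideal.span {((ℓ : ℕ) : integerC K)}) (integerC K) :=
    isAdicComplete_integerC_natCast hK
  haveI : Fact (¬ IsUnit ((ℓ : ℕ) : integerC L)) := ⟨not_isUnit_natCast_integerC hL⟩
  haveI : IsAdicComplete (Ideal.span {((ℓ : ℕ) : integerC L)}) (integerC L) :=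
    isAdicComplete_integerC_natCast hL
  obtain ⟨E, hfin, rE, hmodel, hadm⟩ := hρ
  haveI := hfin
  have hmodel' : Literature.NumberTheory.Automorphic.HasQlModel (ρ.comp (absGaloisRestrict K L)) E
      (rE.comp (absGaloisRestrict K L)) := by
    obtain ⟨P, rfl⟩ := hmodel
    exact ⟨P, ContinuousMonoidHom.ext fun _ => rfl⟩
  refine ⟨E, hfin, rE.comp (absGaloisRestrict K L), hmodel', ?_⟩
  have key := isAdmissible_bdR_restrictField (ℓ := ℓ) hcont hK hL (fontainePst K ℓ hK).algebra
    (fontainePst K ℓ hK).𝔅 (fontainePst_algebra_eq_padicAlgebra hK) (fontainePst_𝔅_eq_bdRPeriodRingData hK)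
    (fontainePst L ℓ hL).algebra (fontainePst L ℓ hL).𝔅 (fontainePst_algebra_eq_padicAlgebra hL)
    (fontainePst_𝔅_eq_bdRPeriodRingData hL)
    (letI := (fontainePst K ℓ hK).algebra; Literature.NumberTheory.Automorphic.restrictScalarsQl E rE) hadm
  exact key

end Assembly

end Literature.NumberTheory.PAdicHodge

end
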